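import Summits.NavierStokesRegularity.NavierStokesRegularity.Theses.PalasekTowerBreakdown
import Summits.NavierStokesRegularity.FluidComputer.ForcedClassicalContinuation
import Summits.NavierStokesRegularity.FluidComputer.PalasekTowerRegisterGlobalEnvelopeAtHolds
import Literature.Analysis.FluidPDE.TaoH1LocalExistenceForcedHolds

/-!
# NavierStokesRegularity — route `PalasekTowerBreakdown`: `LocalContinuationAt k` holds for EVERY
# level, UNCONDITIONALLY — the forced-era crossing of the child crux `HeredityAtOne` is a theorem

Supports `stmt-NavierStokesRegularity-19249` (`PalasekTowerBreakdown.HeredityAtOne := HeredityAtOne`;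
registered skeleton `Cruxes/HeredityAtOne/Lines/birth.lean`, stubs
`stub_continuation_envelope_one : ContinuationEnvelopeAt 1` / `stub_readout_floors_one : ReadoutFloorsAt 1`;
the upper stub splits as `ContinuationEnvelopeAt 1 ↔ LocalContinuationAt 1 ∧ AprioriCeilingAt 1`,
`FluidComputer/PalasekTowerRegisterGlobalEnvelopeAt.lean`). Cell `ns-blowup`, seat
`ns-blowup-ecbridge-1` (g6). LABEL: E–C typing + kernel analysis. WHAT THIS IS NOT: not NS — no stage,
tower or instance is constructed; the child crux is OPEN; what is settled here is the ANALYTIC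
conjunct of its upper half (no premature loss of smoothness at the end of a registered slab), for
every level, with NO named fact left.

The g5 file `Theorems/PalasekTowerBreakdownForcedContinuation.lean` proved these statements modulo
the named fact `Literature.Analysis.FluidPDE.tao2011_smooth_local_existence_forced` (Tao 2013,
Thm. 5.4 (ii)+(iv) WITH forcing). That fact is now a THEOREM of the tree,
`Literature.Analysis.FluidPDE.tao2011_smooth_local_existence_forced_holds`
(`Literature/Analysis/FluidPDE/TaoH1LocalExistenceForcedHolds.lean`, the forced Fourier–Picard
engine: lean2 / lit2 / lit / ecbridge-7 / lit3 seats), so the hypothesis is discharged: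

* `palasekTowerBreakdown_localContinuationAt_holds : ∀ k, LocalContinuationAt k` — every globally
  anchored registered stage at level `k` of a pinned, rigid, quiet schedule on the wide-base rates
  continues as a classical finite-energy solution (same force) STRICTLY PAST its readout `τ k`;
* `palasekTowerBreakdown_continuationEnvelopeAt_one_of_apriori : AprioriCeilingAt 1 →
  ContinuationEnvelopeAt 1` — the registered upper stub of 19249 IS the no-overshoot bet alone;
* `palasekTowerBreakdown_heredityAtOne_of_apriori_floors : AprioriCeilingAt 1 → ReadoutFloorsAt 1 →
  PalasekTowerBreakdown.HeredityAtOne` — the child crux BY NAME from the two physics `∀`-bounds only;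
* `palasekTowerBreakdown_stage_exists_continuation` — the continuation statement for a registered
  stage at any level, hypothesis-free.

References: T. Tao, Anal. PDE 6 (2013), Thm. 5.4 [cite: Tao2011, Thm. 5.4 (ii)+(iv)]; S. Palasek,
arXiv:2605.13827 §4 [cite: Palasek2026ElementaryModel, §4]; P. G. Lemarié-Rieusset, CRC 2016,
Thm. 11.2 (11.11) [cite: LemarieRieusset2016, Thm. 11.2 (11.11)].
-/

-- `Summit.<Summit>.<Problem>` is the tree's mandated summit-side namespace (CONVENTIONS §2); for this
-- single-conjunct summit the two coincide, so the duplicate is deliberate.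
set_option linter.dupNamespace false

namespace Summit.NavierStokesRegularity.NavierStokesRegularity.Theorems

open Summit.NavierStokesRegularity.NavierStokesRegularity.Theses
open Summit.NavierStokesRegularity.FluidComputer.PalasekTowerClayBridge
open Literature.Analysis.FluidPDE

/-- **`LocalContinuationAt k` for EVERY level `k`, unconditionally**: every globally anchored registered
stage at level `k` of a pinned (`Λ = 8`, `θ = 6/5`), rigid, quiet schedule on the wide-base rates, at
unit viscosity, continues as a classical finite-energy solution with the schedule's force strictly past
`τ k` (Tao's forced local `H¹` theory, now a theorem of the tree, fed to the g5 restart loop).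
[cite: Tao2011, Thm. 5.4 (ii)+(iv)] -/
theorem palasekTowerBreakdown_localContinuationAt_holds (k : ℕ) : LocalContinuationAt k :=
  localContinuationAt_of_forced_local_existence tao2011_smooth_local_existence_forced_holds k

/-- **The registered upper stub of item 19249 IS the no-overshoot bet alone**:
`AprioriCeilingAt 1 → ContinuationEnvelopeAt 1` (no named fact). [cite: Palasek2026ElementaryModel, §4] -/
theorem palasekTowerBreakdown_continuationEnvelopeAt_one_of_apriori (hA : AprioriCeilingAt 1) :
    ContinuationEnvelopeAt 1 :=
  continuationEnvelopeAt_of_forced_apriori tao2011_smooth_local_existence_forced_holds le_rfl hA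

/-- **The upper half at every level `k ≥ 1` is the no-overshoot bet alone**:
`AprioriCeilingAt k → ContinuationEnvelopeAt k` (no named fact). [cite: Palasek2026ElementaryModel, §4] -/
theorem palasekTowerBreakdown_continuationEnvelopeAt_of_apriori {k : ℕ} (hk : 1 ≤ k)
    (hA : AprioriCeilingAt k) : ContinuationEnvelopeAt k :=
  continuationEnvelopeAt_of_forced_apriori tao2011_smooth_local_existence_forced_holds hk hA

/-- **The child crux BY NAME from the two physics stubs only**:
`AprioriCeilingAt 1 → ReadoutFloorsAt 1 → PalasekTowerBreakdown.HeredityAtOne` (no named fact).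
[cite: Palasek2026ElementaryModel, §4] -/
theorem palasekTowerBreakdown_heredityAtOne_of_apriori_floors (hA : AprioriCeilingAt 1)
    (hR : ReadoutFloorsAt 1) : PalasekTowerBreakdown.HeredityAtOne :=
  heredityAtOne_of_forced_apriori_floors tao2011_smooth_local_existence_forced_holds hA hR

/-- **Every registered stage of the route's register crosses the end of its slab under the design
force** — unit viscosity, wide rates, route margins; any schedule, any level; NO hypothesis.
[cite: Tao2011, Thm. 5.4 (ii)+(iv)] -/
theorem palasekTowerBreakdown_stage_exists_continuation {S : Schedule TowerRates.wide} {k : ℕ}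
    (s : Stage 1 TowerRates.wide S (Margins.routeG TowerRates.wide) k) :
    ∃ T' : ℝ, S.τ k < T' ∧
      ∃ (U : ℝ → EuclideanSpace ℝ (Fin 3) → EuclideanSpace ℝ (Fin 3))
        (P : ℝ → EuclideanSpace ℝ (Fin 3) → ℝ),
        IsClassicalNSSolutionOn (Set.Icc 0 T') 1 S.f U P ∧
        (∀ t ∈ Set.Icc 0 (S.τ k), U t = s.u t ∧ P t = s.p t) ∧
        (∃ C : ENNReal, C < ⊤ ∧ ∀ t ∈ Set.Icc 0 T', ∫⁻ x, ‖U t x‖ₑ ^ 2 ≤ C) :=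
  s.exists_forced_continuation tao2011_smooth_local_existence_forced_holds one_pos

/-! ## Appendix (g6, append-only): every heredity item of the route IS its physics `∀`-bounds,
level by level, BY NAME — no analytic residue, no named fact

One-liners over ecbridge-7 g3's `FluidComputer/PalasekTowerRegisterGlobalEnvelopeAtHolds.lean`
(`heredityAtOne_iff_aprioriCeilingAt_and_readoutFloorsAt`, `heredityFrom_iff_forall_apriori_and_floors`,
`episodeInductionG_iff_forall_apriori_and_floors`: with `LocalContinuationAt k` a theorem for every `k`, the
lossless splits lose their analytic conjunct), stated against the route's Theses decls. -/

/-- **Item 19249 BY NAME IS its two physics stubs**: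
`PalasekTowerBreakdown.HeredityAtOne ↔ AprioriCeilingAt 1 ∧ ReadoutFloorsAt 1` (no hypothesis).
[cite: Palasek2026ElementaryModel, §4] -/
theorem palasekTowerBreakdown_heredityAtOne_iff_apriori_floors :
    PalasekTowerBreakdown.HeredityAtOne ↔ AprioriCeilingAt 1 ∧ ReadoutFloorsAt 1 :=
  heredityAtOne_iff_aprioriCeilingAt_and_readoutFloorsAt

/-- **Item 19250 BY NAME IS the two physics `∀`-bounds at every level `k ≥ 2`** (levelwise companion of
`palasekTowerBreakdown_heredityFromTwo_iff_apriori_floors` of `Theorems/PalasekTowerBreakdownHeredityFromTwoApriori.lean`,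
which uses the aggregated `AprioriCeiling ∧ ReadoutFloors`):
`PalasekTowerBreakdown.HeredityFromTwo ↔ ∀ k ≥ 2, AprioriCeilingAt k ∧ ReadoutFloorsAt k` (no hypothesis).
[cite: Palasek2026ElementaryModel, §4] -/
theorem palasekTowerBreakdown_heredityFromTwo_iff_aprioriAt_floorsAt :
    PalasekTowerBreakdown.HeredityFromTwo ↔ ∀ k : ℕ, 2 ≤ k → AprioriCeilingAt k ∧ ReadoutFloorsAt k :=
  heredityFrom_iff_forall_apriori_and_floors one_le_two

/-- **The parent crux 19178 BY NAME IS the two physics `∀`-bounds at every level `k ≥ 1`** (levelwise, the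
first rung included; companion of `palasekTowerBreakdown_episodeInduction_iff_apriori`):
`PalasekTowerBreakdown.EpisodeInduction ↔ ∀ k ≥ 1, AprioriCeilingAt k ∧ ReadoutFloorsAt k` (no hypothesis).
[cite: Palasek2026ElementaryModel, §4] -/
theorem palasekTowerBreakdown_episodeInduction_iff_aprioriAt_floorsAt :
    PalasekTowerBreakdown.EpisodeInduction ↔ ∀ k : ℕ, 1 ≤ k → AprioriCeilingAt k ∧ ReadoutFloorsAt k :=
  episodeInductionG_iff_forall_apriori_and_floors

end Summit.NavierStokesRegularity.NavierStokesRegularity.Theorems
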